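import Literature.AnabelianGeometry.SemiGraphs.PSCCoveringBranchDataProofs
import Literature.AnabelianGeometry.SemiGraphs.PSCCoveringMapAlong
import Literature.AnabelianGeometry.SemiGraphs.PSCGraphicitySub
import HarnessLib

/-!
# [CombGC] Rmk. 1.1.3 `i(G_U) ≤ n(G_U) + 1` is HEREDITARY: finite étale coverings and maximal pro-`S` quotients

Mochizuki, *A combinatorial version of the Grothendieck conjecture* [CombGC] §1, Def. 1.1 (ii) p. 6
(finite étale `Π_G`-coverings), Rmk. 1.1.3 p. 8, Thm. 1.6 (i) p. 13 ("we may assume that `Σ = {l}`").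
[cite: MochizukiCombGC2007, Rmk 1.1.3 p.8] [cite: MochizukiCombGC2007, Def 1.1(ii) p.6]

PROOF-ONLY file (abc-iut cell, [CombGC] non-vacuity programme; seat abc-iut-w4-d052 gen 4; sequel of
`PSCVertCountConnectivity*.lean`).  The sub-node row F-3810 `PSCDatum.VertCountLeNodeCountSucc`
(`i(G_U) ≤ n(G_U) + 1` for every open `U`) is a statement about ALL coverings of `G` at once, so it is
inherited by the two operations of the `Σ = {l}` reduction in the proof of [CombGC] Thm. 1.6:

* `VertCountLeNodeCountSucc.restrictBD` — by every finite étale covering datum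
  `G.restrictBD U hU bd` (abc-iut-L3-t4, ANY branch data; the counts of the sub-covering attached to
  `V ≤ U` are those of `G_V`, `restrictBD_vertCount_subgroupOf` / `restrictBD_nodeCount_subgroupOf`);
* `VertCountLeNodeCountSucc.mapAlong` — by the image datum along any continuous surjection
  `f : Π_G ↠ Q` onto a pro-`S` group (`mapAlong_vertCount` / `mapAlong_nodeCount` at `H = f⁻¹ H'`).

Consequently an origin that is the finite-étale-covering tower of ONE datum satisfying F-3810 (e.g. the
genuine two-component / two-tripod / irreducible-nodal data of `PSCVertCountConnectivityShapes.lean`,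
`…Nodal.lean`) satisfies F-3811 `VertCountLeNodeCountSuccHolds` at every level — the covering-closed
reading asked for by abc-iut-w5-d174's `PSCOriginVertexGrowth.lean`, for this row.  Group theory over
the interface; nothing here takes a side on [IUTchIII] Cor. 3.12.
-/

noncomputable section

namespace Literature.AnabelianGeometry.SemiGraphs

universe u

namespace PSCDatum

variable {P : Type u} [Group P] [TopologicalSpace P] [IsTopologicalGroup P]

/-- **F-3810 passes to finite étale coverings** (any branch data): if every covering of `G` has
`i ≤ n + 1`, so does every covering of `G_U` — the covering of `G_U` attached to an open `V ≤ U` is the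
covering `G_V` of `G`. [cite: MochizukiCombGC2007, Def 1.1(ii) p.6] -/
theorem VertCountLeNodeCountSucc.restrictBD [CompactSpace P] {G : PSCDatum P}
    (h : G.VertCountLeNodeCountSucc) (U : Subgroup P) [U.FiniteIndex] (hU : IsOpen (U : Set P))
    (bd : G.BranchData) : (G.restrictBD U hU bd).VertCountLeNodeCountSucc := by
  intro V hV
  -- `V ≤ U` as a subgroup `W` of `Π`, open
  set W : Subgroup P := V.map U.subtype with hW
  have hWU : W ≤ U := Subgroup.map_subtype_le V
  have hWo : IsOpen (W : Set P) := by
    have : (W : Set P) = Subtype.val '' (V : Set U) := by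
      ext x; simp [hW]
    rw [this]
    exact hU.isOpenMap_subtype_val _ hV
  haveI : Finite (P ⧸ W) := Subgroup.quotient_finite_of_isOpen W hWo
  haveI : W.FiniteIndex := Subgroup.finiteIndex_of_finite_quotient
  have hVW : V = W.subgroupOf U := by
    rw [Subgroup.subgroupOf, hW, Subgroup.comap_map_eq_self_of_injective U.subtype_injective]
  rw [hVW, G.restrictBD_vertCount_subgroupOf U hU bd W hWU, G.restrictBD_nodeCount_subgroupOf U hU bd W hWU]
  exact h W hWo

omit [IsTopologicalGroup P] in
/-- **F-3810 passes to the image along a continuous surjection onto a pro-`S` group** (in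
particular along a presentation of the maximal pro-`l` quotient, "we may assume `Σ = {l}`"): the
covering of the image datum attached to an open `H' ≤ Q` has the counts of the covering `G_{f⁻¹H'}`.
[cite: MochizukiCombGC2007, Thm 1.6(i) p.13] -/
theorem VertCountLeNodeCountSucc.mapAlong [CompactSpace P] {Q : Type u} [Group Q] [TopologicalSpace Q]
    [IsTopologicalGroup Q] [T2Space Q] {G : PSCDatum P} (h : G.VertCountLeNodeCountSucc) (f : P →* Q)
    (hf : Continuous f) (hs : Function.Surjective f) (S : Set ℕ) (hS : S ⊆ G.Sigma) (hne : S.Nonempty)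
    (hQ : IsProSigma S Q) : (G.mapAlong f hf S hS hne hQ).VertCountLeNodeCountSucc := by
  intro H' hH'
  have hker : f.ker ≤ H'.comap f := fun x hx => by
    rw [Subgroup.mem_comap, (MonoidHom.mem_ker).mp hx]
    exact H'.one_mem
  have hH : H' = (H'.comap f).map f := (Subgroup.map_comap_eq_self_of_surjective hs H').symm
  rw [hH, G.mapAlong_vertCount f hf S hS hne hQ hs hker, G.mapAlong_nodeCount f hf S hS hne hQ hs hker]
  exact h (H'.comap f) (hH'.preimage hf)

end PSCDatum

end Literature.AnabelianGeometry.SemiGraphs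

end
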